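import Summits.RiemannHypothesis.RiemannHypothesis.Theorems.WeilColumnThetaAtomBound
import Summits.RiemannHypothesis.RiemannHypothesis.Theorems.WeilColumnMollifierSup
import Summits.RiemannHypothesis.RiemannHypothesis.Theorems.HandoffWindow
import Summits.RiemannHypothesis.RiemannHypothesis.Theorems.MotivicDoorSemilocalThreshold
import HarnessLib

/-!
# THETA kernel certificate, D4 part 3: the atom term of the MOLLIFIED witness `φ_k = g⁻ ⋆ moll_k` and the atom side of FIN (RH-FREE)

Cell `rh-explicit`, WEIL column, seat weil-1 gen19 (THETA-ASSIGN v1.0 §3 items D4/FIN; THETA-CERT-cc6 §D4/§D9). For an admissible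
row `P : ThetaParams`:

* §1 the MOLLIFIED witness `φ_k = g⁻ ⋆ moll_k`: `k_{φ_k}(t) → k(t)` (dominated convergence: `‖φ_k‖ ≤ sup‖g⁻‖`, supports in
  `[−a−1, a+1]`), hence for every `e > 0`, eventually `(log q/√q)·Re(k_{φ_k}(log q) + k_{φ_k}(−log q)) ≤ −2 log q·I + atom + e`.
* §2 with the HANDOFF window identity (`Handoff.weilQuadratic_eq_handoff_of_consecutive`) for consecutive primes `q < q⁺`:
  eventually in `k`, **`Re Q_{S_q}(φ_k) ≤ Re Q(φ_k) − 2 log q·I + atom + e`** — the atom side of FIN, leaving only (P_R)'s bound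
  on `Re Q(φ_k)` and D8's `gain ≤ 2 log q·I`;
* §3 the shape FIN ends with: a mollified witness in the next window with `Re Q_{S_q}(φ_k) < 0` gives
  `a*(S_q) < (log q⁺)/2` (`MotivicDoor.SemilocalThreshold`), hence **`weilSemilocalThreshold_lt_of_full_le`**: any ceiling
  `Re Q(φ_k) ≤ B + e` (eventually, every `e > 0`) with `B − 2 log q·I + atom < 0` yields `weilSemilocalThreshold (primesBelow q) < (log q⁺)/2`.

Upper-clause bookkeeping only; nothing here bears on the truth of RH.
-/

noncomputable section

set_option linter.dupNamespace false

open Complex Set MeasureTheory Filter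
open scoped Real Topology ComplexConjugate

namespace Summit.RiemannHypothesis.RiemannHypothesis.Theorems.WeilColumn.ThetaMellin

open Literature.NumberTheory.LFunctions ThetaParams

namespace ThetaParams

variable {P : ThetaParams}

/-! ## §1 The mollified witness: `k_{φ_k}(t) → k(t)` and the eventual atom inequality -/

/-- **The autocorrelation kernel of `φ_k = g⁻ ⋆ moll_k` converges pointwise to that of `g⁻`**:
`(φ_k ⋆ φ̃_k)(t) → (g⁻ ⋆ g̃⁻)(t)` as `k → ∞` (dominated convergence; `‖φ_k‖ ≤ sup ‖g⁻‖`, all supports in `[−a−1, a+1]`). [folklore] -/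
theorem tendsto_weilConv_weilReflect_phi {qn : ℕ} (hP : P.Admissible qn) (t : ℝ) :
    Tendsto (fun k ↦ weilConv (P.phi k) (weilReflect (P.phi k)) t) atTop
      (𝓝 (weilConv P.gOdd (weilReflect P.gOdd) t)) := by
  have hgc := continuous_gOdd hP
  obtain ⟨S, hS⟩ := hgc.bounded_above_of_compact_support (hasCompactSupport_gOdd hP)
  have hS0 : 0 ≤ S := (norm_nonneg _).trans (hS 0)
  -- uniform sup bound and uniform support of the mollified witnesses
  have hφb : ∀ k u, ‖P.phi k u‖ ≤ S := fun k u ↦ norm_weilConv_moll_le_of_local_bound k fun v _ ↦ hS v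
  have hφ0 : ∀ k u, P.a + 1 < |u| → P.phi k u = 0 := by
    intro k u hu
    refine phi_eq_zero_of_lt_abs hP k (lt_of_le_of_lt ?_ hu)
    have hk : (1 : ℝ) / ((k : ℝ) + 1) ≤ 1 := by
      rw [div_le_one (by positivity)]; linarith [(Nat.cast_nonneg k : (0 : ℝ) ≤ k)]
    linarith
  simp only [weilConv_apply]
  refine tendsto_integral_of_dominated_convergence ((Icc (-(P.a + 1)) (P.a + 1)).indicator fun _ ↦ S * S) ?_ ?_ ?_ ?_
  · intro k
    exact ((continuous_phi hP k).mul (Complex.continuous_conj.comp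
      ((continuous_phi hP k).comp (continuous_const.sub continuous_id).neg))).aestronglyMeasurable
  · exact (continuous_const.integrableOn_Icc (a := -(P.a + 1)) (b := P.a + 1)).integrable_indicator measurableSet_Icc
  · intro k
    refine Eventually.of_forall fun u ↦ ?_
    by_cases hu : u ∈ Icc (-(P.a + 1)) (P.a + 1)
    · rw [indicator_of_mem hu, weilReflect, norm_mul, Complex.norm_conj]
      exact mul_le_mul (hφb k u) (hφb k _) (norm_nonneg _) hS0
    · rw [indicator_of_notMem hu]
      have : P.a + 1 < |u| := by
        rw [mem_Icc, not_and_or, not_le, not_le] at hu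
        rcases hu with hu | hu
        · rw [abs_of_neg (by linarith [a_pos hP])]; linarith
        · rw [abs_of_pos (by linarith [a_pos hP])]; linarith
      rw [hφ0 k u this, zero_mul, norm_zero]
  · refine Eventually.of_forall fun u ↦ ?_
    have h1 : Tendsto (fun k ↦ P.phi k u) atTop (𝓝 (P.gOdd u)) := WeilContinuous.tendsto_weilConv_moll hgc u
    have h2 : Tendsto (fun k ↦ weilReflect (P.phi k) (t - u)) atTop (𝓝 (weilReflect P.gOdd (t - u))) := by
      simp only [weilReflect]
      exact (Complex.continuous_conj.tendsto _).comp (WeilContinuous.tendsto_weilConv_moll hgc (-(t - u)))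
    exact h1.mul h2

/-- The atom functional `(log q/√q)·Re(k(log q) + k(−log q))` along the mollified witnesses converges to its value at `g⁻`. [folklore] -/
theorem tendsto_atom_phi {qn : ℕ} (hP : P.Admissible qn) :
    Tendsto (fun k ↦ Real.log P.q / Real.sqrt P.q *
        (weilConv (P.phi k) (weilReflect (P.phi k)) (Real.log P.q) +
          weilConv (P.phi k) (weilReflect (P.phi k)) (-Real.log P.q)).re) atTop
      (𝓝 (Real.log P.q / Real.sqrt P.q *
        (weilConv P.gOdd (weilReflect P.gOdd) (Real.log P.q) + weilConv P.gOdd (weilReflect P.gOdd) (-Real.log P.q)).re)) := by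
  have h := (tendsto_weilConv_weilReflect_phi hP (Real.log P.q)).add (tendsto_weilConv_weilReflect_phi hP (-Real.log P.q))
  exact ((Complex.continuous_re.tendsto _).comp h).const_mul _

/-- **THE ATOM INEQUALITY FOR THE MOLLIFIED WITNESS (eventually)**: for every `e > 0`, for all large `k`,
`(log q/√q)·Re(k_{φ_k}(log q) + k_{φ_k}(−log q)) ≤ −2 log q·I + atom + e`. [THETA-CERT-cc6 §D4/§D9] -/
theorem eventually_atom_phi_le {qn : ℕ} (hP : P.Admissible qn) (hq : 2 ≤ P.q) {e : ℝ} (he : 0 < e) :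
    ∀ᶠ k : ℕ in atTop, Real.log P.q / Real.sqrt P.q *
        (weilConv (P.phi k) (weilReflect (P.phi k)) (Real.log P.q) +
          weilConv (P.phi k) (weilReflect (P.phi k)) (-Real.log P.q)).re ≤ -2 * Real.log P.q * P.Itop + P.atom + e := by
  have hlim := tendsto_atom_phi hP
  have hlt := atom_re_le hP hq
  filter_upwards [(tendsto_order.1 hlim).2 _ (show _ < -2 * Real.log P.q * P.Itop + P.atom + e by linarith)] with k hk
  exact hk.le


/-! ## §2 The atom side of FIN: `Re Q_{S_q}(φ_k) ≤ Re Q(φ_k) − 2 log q·I + atom + e` eventually -/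

/-- **Semilocal = full + atom, for the mollified witness (eventually in `k`)**: for consecutive primes `q < q⁺`,
`Re Q_{S_q}(φ_k) = Re Q(φ_k) + (log q/√q)·Re(k_{φ_k}(log q) + k_{φ_k}(−log q))` as soon as `tsupport φ_k ⊆ [−(log q⁺)/2, (log q⁺)/2]`.
[cite: Connes1999, §VII Thm 4; this tree `Handoff.weilQuadratic_eq_handoff_of_consecutive`] -/
theorem eventually_re_weilSemilocalQuadratic_phi_eq {qn : ℕ} (hP : P.Admissible qn) (hcons : Handoff.ConsecutivePrimes P.q qn) :
    ∀ᶠ k : ℕ in atTop, (weilSemilocalQuadratic (Nat.primesBelow P.q) (P.phi k)).re =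
      (weilQuadratic (P.phi k)).re + Real.log P.q / Real.sqrt P.q *
        (weilConv (P.phi k) (weilReflect (P.phi k)) (Real.log P.q) +
          weilConv (P.phi k) (weilReflect (P.phi k)) (-Real.log P.q)).re := by
  have hq : 1 ≤ P.q := le_trans (by norm_num) hcons.1.two_le
  filter_upwards [eventually_tsupport_phi_subset_window hP hq] with k hk
  rw [Handoff.weilQuadratic_eq_handoff_of_consecutive hcons (isWeilTest_phi hP k) hk, Complex.sub_re, Complex.re_ofReal_mul]
  ring

/-- **THE ATOM SIDE OF FIN**: for consecutive primes `q < q⁺` and every `e > 0`, for all large `k`,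
`Re Q_{S_q}(φ_k) ≤ Re Q(φ_k) − 2 log q·I + atom + e`. [THETA-CERT-cc6 §D4/§D9; THETA-ASSIGN v1.0 FIN] -/
theorem eventually_re_weilSemilocalQuadratic_phi_le {qn : ℕ} (hP : P.Admissible qn) (hcons : Handoff.ConsecutivePrimes P.q qn)
    {e : ℝ} (he : 0 < e) :
    ∀ᶠ k : ℕ in atTop, (weilSemilocalQuadratic (Nat.primesBelow P.q) (P.phi k)).re ≤
      (weilQuadratic (P.phi k)).re - 2 * Real.log P.q * P.Itop + P.atom + e := by
  filter_upwards [eventually_re_weilSemilocalQuadratic_phi_eq hP hcons, eventually_atom_phi_le hP hcons.1.two_le he] with k hk hle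
  rw [hk]
  linarith


/-! ## §3 From a negative mollified witness to the threshold `a*(S_q) < (log q⁺)/2` (the shape FIN ends with) -/

/-- A mollified witness supported in the next window with `Re Q_{S_q}(φ_k) < 0` puts the semilocal threshold below `(log q⁺)/2`.
[folklore; `MotivicDoor.SemilocalThreshold.not_weilSemilocalPositivityOn_iff_weilSemilocalThreshold_lt`] -/
theorem weilSemilocalThreshold_lt_of_phi_neg {qn : ℕ} (hP : P.Admissible qn) {k : ℕ}
    (hk : tsupport (P.phi k) ⊆ Icc (-(Real.log qn / 2)) (Real.log qn / 2))
    (hneg : (weilSemilocalQuadratic (Nat.primesBelow P.q) (P.phi k)).re < 0) :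
    MotivicDoor.SemilocalThreshold.weilSemilocalThreshold (Nat.primesBelow P.q) < Real.log qn / 2 :=
  MotivicDoor.SemilocalThreshold.not_weilSemilocalPositivityOn_iff_weilSemilocalThreshold_lt.1
    fun hpos ↦ (not_le.2 hneg) (hpos _ (isWeilTest_phi hP k) hk)

/-- **UC FROM A FULL-FORM CEILING (atom side + window, assembled)**: for consecutive primes `q < q⁺`, if eventually in `k`
`Re Q(φ_k) ≤ B + e` for every `e > 0` (the (P_R) bound supplies `B = primesC + cross + arch t₀`) and
`B − 2 log q·I + atom < 0` (`loss < gain ≤ 2 log q·I`), then `a*(S_q) < (log q⁺)/2`. [THETA-ASSIGN v1.0 (AN)/FIN shape] -/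
theorem weilSemilocalThreshold_lt_of_full_le {qn : ℕ} (hP : P.Admissible qn) (hcons : Handoff.ConsecutivePrimes P.q qn)
    {B : ℝ} (hB : ∀ e : ℝ, 0 < e → ∀ᶠ k : ℕ in atTop, (weilQuadratic (P.phi k)).re ≤ B + e)
    (hlt : B - 2 * Real.log P.q * P.Itop + P.atom < 0) :
    MotivicDoor.SemilocalThreshold.weilSemilocalThreshold (Nat.primesBelow P.q) < Real.log qn / 2 := by
  have hq : 1 ≤ P.q := le_trans (by norm_num) hcons.1.two_le
  set e : ℝ := -(B - 2 * Real.log P.q * P.Itop + P.atom) / 3 with he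
  have he0 : 0 < e := by rw [he]; linarith
  obtain ⟨k, hk1, hk2, hk3⟩ := ((eventually_tsupport_phi_subset_window hP hq).and
    ((eventually_re_weilSemilocalQuadratic_phi_le hP hcons he0).and (hB e he0))).exists
  refine weilSemilocalThreshold_lt_of_phi_neg hP hk1 ?_
  have : (weilSemilocalQuadratic (Nat.primesBelow P.q) (P.phi k)).re ≤ -e := by
    have h3 : (B - 2 * Real.log P.q * P.Itop + P.atom) = -3 * e := by rw [he]; ring
    linarith
  linarith

end ThetaParams

end Summit.RiemannHypothesis.RiemannHypothesis.Theorems.WeilColumn.ThetaMellin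

end
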